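import Mathlib.Analysis.Calculus.ContDiff.Bounds
import Literature.Geometry.Lorentzian.KerrConvergence
import HarnessLib

/-!
# `Cᵏ` estimates for the coordinate pullback of a field of bilinear forms
(topic `Geometry/Lorentzian`; the analytic core of the chart-independence and diagonal lemmas for
pointed `Cᵏ_loc` convergence of spacetimes, `SpacetimeLocalConvergence.lean`)

For a map `θ : E → F` between real normed spaces (a chart transition, or a comparison map read in
two charts) and a field `B : F → (F →L F →L ℝ)` of continuous bilinear forms on `F` (the
components of a metric, or of a metric deviation, in a chart), the **coordinate pullback**
`bilinPullback θ B : E → (E →L E →L ℝ)` is `y ↦ B(θ y)(Dθ_y ·, Dθ_y ·)` — the transformation law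
of a covariant `2`-tensor (O'Neill 1983, Ch. 3, Def. 3.9 with `f = θ`; Petersen 2006, Ch. 10,
§3.2: convergence of tensors is checked on their components in charts, "clearly independent of the
covering", i.e. stable under exactly this operation).

Main results (all `[folklore]`; Leibniz + Faà di Bruno, via Mathlib's
`norm_iteratedFDerivWithin_comp_le` and `ContinuousLinearMap.norm_iteratedFDerivWithin_le_of_bilinear`):

* `bilinPullback_apply`, `bilinPullback_sub`, `bilinPullback_zero`: the operation and its
  linearity in `B`.
* `ContDiffOn.bilinPullback`: `θ ∈ C^{n+1}`, `B ∈ Cⁿ` ⇒ `bilinPullback θ B ∈ Cⁿ`.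
* `norm_iteratedFDeriv_bilinPullback_le`: the LINEAR `Cᵏ` ESTIMATE
  `‖Dᵐ(bilinPullback θ B)(x)‖ ≤ 4ᵏ k! Θ^{k+2} · N` for `m ≤ k`, where `Θ ≥ 1` bounds
  `‖Dⁱθ(x)‖`, `1 ≤ i ≤ k + 1`, and `N` bounds `‖Dʲ B(θ x)‖`, `j ≤ k`.
* `tendsto_supCkENorm_bilinPullback`: consequently, if the `Cᵏ` sup norms (`supCkENorm`) of a
  family `B i` tend to `0` on a set `K' ⊇ θ(K)`, `K` compact inside the open set where `θ` is
  smooth, then the `Cᵏ` sup norms of `bilinPullback θ (B i)` on `K` tend to `0` — pulling back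
  along a FIXED smooth map is continuous for `Cᵏ_loc` convergence to `0`.

## References
* [ONeill1983] B. O'Neill, *Semi-Riemannian Geometry*, Academic Press 1983, Ch. 3, Def. 3.9.
* [Petersen2006] P. Petersen, *Riemannian Geometry*, 2nd ed., GTM 171, Springer 2006, Ch. 10, §3.2.
-/

noncomputable section

open Set Filter Topology Function
open scoped ENNReal ContDiff Nat

namespace Literature.Geometry.Lorentzian

section SupNormAPI

variable {F G : Type*} [NormedAddCommGroup F] [NormedSpace ℝ F] [NormedAddCommGroup G]
  [NormedSpace ℝ G]

/-- Introduction rule for bounds on the `Cᵏ` sup norm: a common bound on all `‖Dᵐ f(x)‖ₑ`,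
`m ≤ k`, `x ∈ S`, bounds `supCkENorm S k f`. [folklore] -/
theorem supCkENorm_le_of_forall_le {S : Set F} {k : ℕ} {f : F → G} {C : ℝ≥0∞}
    (h : ∀ m, m ≤ k → ∀ x ∈ S, ‖iteratedFDeriv ℝ m f x‖ₑ ≤ C) : supCkENorm S k f ≤ C :=
  iSup₂_le fun m hm ↦ iSup₂_le fun x hx ↦ h m hm x hx

/-- Real-valued pointwise bound from a finite `Cᵏ` sup norm: `‖Dᵐ f(x)‖ ≤ (supCkENorm S k f).toReal`
for `m ≤ k`, `x ∈ S`. [folklore] -/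
theorem norm_iteratedFDeriv_le_toReal_supCkENorm {S : Set F} {k m : ℕ} (hm : m ≤ k) {x : F}
    (hx : x ∈ S) (f : F → G) (hfin : supCkENorm S k f ≠ ⊤) :
    ‖iteratedFDeriv ℝ m f x‖ ≤ (supCkENorm S k f).toReal := by
  rw [← ENNReal.ofReal_le_iff_le_toReal hfin, ofReal_norm]
  exact enorm_iteratedFDeriv_le_supCkENorm hm hx f

/-- A uniform real bound on all derivatives of order `≤ k` on `S` bounds the `Cᵏ` sup norm by
`ENNReal.ofReal` of that bound. [folklore] -/
theorem supCkENorm_le_ofReal {S : Set F} {k : ℕ} {f : F → G} {C : ℝ}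
    (h : ∀ m, m ≤ k → ∀ x ∈ S, ‖iteratedFDeriv ℝ m f x‖ ≤ C) :
    supCkENorm S k f ≤ ENNReal.ofReal C :=
  supCkENorm_le_of_forall_le fun m hm x hx ↦ by
    rw [← ofReal_norm]
    exact ENNReal.ofReal_le_ofReal (h m hm x hx)

end SupNormAPI

section BilinPullback

variable {E F : Type*} [NormedAddCommGroup E] [NormedSpace ℝ E] [NormedAddCommGroup F]
  [NormedSpace ℝ F]

/-- The **coordinate pullback** of a field of continuous bilinear forms `B` on `F` along
`θ : E → F`: `(bilinPullback θ B)(y)(v, w) = B(θ y)(Dθ_y v, Dθ_y w)` (Mathlib's `fderiv`; junk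
where `θ` is not differentiable). The transformation law of the components of a covariant
`2`-tensor under the coordinate change `θ` (O'Neill 1983, Ch. 3, Def. 3.9 with `f = θ`; it is
`pullbackBilin` of `Isometry.lean` for the trivial model `𝓘(ℝ, ·)`, spelled with `fderiv`).
[cite: ONeill1983, Ch. 3, Def. 3.9] -/
def bilinPullback (θ : E → F) (B : F → F →L[ℝ] F →L[ℝ] ℝ) : E → E →L[ℝ] E →L[ℝ] ℝ :=
  fun y ↦ (ContinuousLinearMap.precomp ℝ (fderiv ℝ θ y)).comp ((B (θ y)).comp (fderiv ℝ θ y))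

/-- `(bilinPullback θ B)(y)(v, w) = B(θ y)(Dθ_y v, Dθ_y w)`. [cite: ONeill1983, Ch. 3, Def. 3.9] -/
@[simp]
theorem bilinPullback_apply (θ : E → F) (B : F → F →L[ℝ] F →L[ℝ] ℝ) (y v w : E) :
    bilinPullback θ B y v w = B (θ y) (fderiv ℝ θ y v) (fderiv ℝ θ y w) := rfl

/-- The coordinate pullback is additive in the field (it is linear in `B`). [folklore] -/
theorem bilinPullback_sub (θ : E → F) (B₁ B₂ : F → F →L[ℝ] F →L[ℝ] ℝ) :
    bilinPullback θ (B₁ - B₂) = bilinPullback θ B₁ - bilinPullback θ B₂ := by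
  funext y
  ext v w
  simp [bilinPullback_apply]

/-- The coordinate pullback of the zero field vanishes. [folklore] -/
@[simp]
theorem bilinPullback_zero (θ : E → F) :
    bilinPullback θ (0 : F → F →L[ℝ] F →L[ℝ] ℝ) = 0 := by
  funext y
  ext v w
  simp [bilinPullback_apply]

/-- Pointwise form of `bilinPullback_sub`. [folklore] -/
theorem bilinPullback_sub_apply (θ : E → F) (B₁ B₂ : F → F →L[ℝ] F →L[ℝ] ℝ) (y : E) :
    bilinPullback θ (B₁ - B₂) y = bilinPullback θ B₁ y - bilinPullback θ B₂ y := by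
  rw [bilinPullback_sub]
  rfl

/-- The coordinate pullback at `y` only depends on the germ of `θ` at `y` and on the value of `B`
along it: if `θ₁ =ᶠ[𝓝 y] θ₂` then `bilinPullback θ₁ B y = bilinPullback θ₂ B y`. [folklore] -/
theorem bilinPullback_congr_of_eventuallyEq {θ₁ θ₂ : E → F} {y : E} (h : θ₁ =ᶠ[𝓝 y] θ₂)
    (B : F → F →L[ℝ] F →L[ℝ] ℝ) : bilinPullback θ₁ B y = bilinPullback θ₂ B y := by
  ext v w
  rw [bilinPullback_apply, bilinPullback_apply, h.fderiv_eq, h.eq_of_nhds]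

/-- The continuous linear map `L ↦ (f ↦ f ∘ L)` implementing `ContinuousLinearMap.precomp` as a
function of the inner map: `precomp ℝ L = (compL ℝ E F ℝ).flip L`. [folklore] -/
theorem precomp_eq_flip_compL (L : E →L[ℝ] F) :
    (ContinuousLinearMap.precomp ℝ L : (F →L[ℝ] ℝ) →L[ℝ] E →L[ℝ] ℝ) =
      (ContinuousLinearMap.compL ℝ E F ℝ).flip L := by
  ext f v
  simp

/-- **Smoothness of the coordinate pullback**: if `θ` is `C^{n+1}` on an open set `s`, `B` is `Cⁿ`
on `t` and `θ(s) ⊆ t`, then `bilinPullback θ B` is `Cⁿ` on `s` (the components `B ∘ θ` are `Cⁿ`,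
the Jacobian `Dθ` is `Cⁿ`, and the expression is bilinear in them). [folklore] -/
theorem ContDiffOn.bilinPullback {θ : E → F} {B : F → F →L[ℝ] F →L[ℝ] ℝ} {s : Set E} {t : Set F}
    {n : ℕ∞} (hθ : ContDiffOn ℝ (n + 1) θ s) (hB : ContDiffOn ℝ n B t) (hs : IsOpen s)
    (hst : MapsTo θ s t) : ContDiffOn ℝ n (bilinPullback θ B) s := by
  have hL : ContDiffOn ℝ n (fderiv ℝ θ) s := hθ.fderiv_of_isOpen hs le_rfl
  have hθ' : ContDiffOn ℝ n θ s := hθ.of_le (by exact_mod_cast le_self_add)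
  have hBθ : ContDiffOn ℝ n (fun y ↦ B (θ y)) s := hB.comp hθ' hst
  have hQ : ContDiffOn ℝ n (fun y ↦ (B (θ y)).comp (fderiv ℝ θ y)) s := hBθ.clm_comp hL
  have hP : ContDiffOn ℝ n
      (fun y ↦ (ContinuousLinearMap.precomp ℝ (fderiv ℝ θ y) : (F →L[ℝ] ℝ) →L[ℝ] E →L[ℝ] ℝ)) s := by
    have : (fun y ↦ (ContinuousLinearMap.precomp ℝ (fderiv ℝ θ y) : (F →L[ℝ] ℝ) →L[ℝ] E →L[ℝ] ℝ)) =
        (ContinuousLinearMap.compL ℝ E F ℝ).flip ∘ fderiv ℝ θ := by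
      funext y
      exact precomp_eq_flip_compL _
    rw [this]
    exact (ContinuousLinearMap.contDiff _).comp_contDiffOn hL
  exact hP.clm_comp hQ

/-! ### The linear `Cᵏ` estimate -/

/-- Derivatives of the Jacobian: `‖Dʲ(Dθ)(x)‖ = ‖D^{j+1}θ(x)‖` on an open set. [folklore] -/
theorem norm_iteratedFDeriv_fderiv_of_isOpen {θ : E → F} {s : Set E} (hs : IsOpen s)
    {x : E} (hx : x ∈ s) (j : ℕ) :
    ‖iteratedFDeriv ℝ j (fderiv ℝ θ) x‖ = ‖iteratedFDeriv ℝ (j + 1) θ x‖ := by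
  have h1 : iteratedFDerivWithin ℝ j (fderiv ℝ θ) s x =
      iteratedFDerivWithin ℝ j (fderivWithin ℝ θ s) s x :=
    iteratedFDerivWithin_congr (fun y hy ↦ (fderivWithin_of_isOpen hs hy).symm) hx j
  rw [← iteratedFDerivWithin_of_isOpen j hs hx, ← iteratedFDerivWithin_of_isOpen (j + 1) hs hx, h1,
    norm_iteratedFDerivWithin_fderivWithin hs.uniqueDiffOn hx]

/-- Faà di Bruno bound for the components along `θ`: with `Θ ≥ 1` bounding `‖Dⁱθ(x)‖`
(`1 ≤ i ≤ k`) and `N` bounding `‖DʲB(θ x)‖` (`j ≤ k`), `‖Dᶜ(B ∘ θ)(x)‖ ≤ c! · N · Θᶜ` for `c ≤ k`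
(Mathlib's `norm_iteratedFDerivWithin_comp_le`). [folklore] -/
theorem norm_iteratedFDeriv_comp_le_of_bounds {θ : E → F} {B : F → F →L[ℝ] F →L[ℝ] ℝ}
    {s : Set E} {t : Set F} (hs : IsOpen s) (ht : IsOpen t) {k : ℕ}
    (hθ : ContDiffOn ℝ k θ s) (hB : ContDiffOn ℝ k B t) (hst : MapsTo θ s t)
    {x : E} (hx : x ∈ s) {Θ N : ℝ} (hΘ₁ : 1 ≤ Θ)
    (hθb : ∀ i, 1 ≤ i → i ≤ k → ‖iteratedFDeriv ℝ i θ x‖ ≤ Θ)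
    (hBb : ∀ j, j ≤ k → ‖iteratedFDeriv ℝ j B (θ x)‖ ≤ N) {c : ℕ} (hc : c ≤ k) :
    ‖iteratedFDeriv ℝ c (fun y ↦ B (θ y)) x‖ ≤ c ! * N * Θ ^ c := by
  have key := norm_iteratedFDerivWithin_comp_le (g := B) (f := θ) (n := c)
    (N := (k : ℕ∞)) (x := x) hB hθ (by exact_mod_cast hc) ht.uniqueDiffOn hs.uniqueDiffOn hst hx
    (C := N) (D := Θ) (fun i hi ↦ ?_) (fun i h1 hi ↦ ?_)
  · rwa [iteratedFDerivWithin_of_isOpen c hs hx] at key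
  · rw [iteratedFDerivWithin_of_isOpen i ht (hst hx)]
    exact hBb i (hi.trans hc)
  · rw [iteratedFDerivWithin_of_isOpen i hs hx]
    exact (hθb i h1 (hi.trans hc)).trans (le_self_pow₀ hΘ₁ (by omega))

/-- Auxiliary arithmetic: `∑_{i ≤ n} C(n, i) = 2ⁿ` in `ℝ`. [folklore] -/
theorem sum_range_choose_real (n : ℕ) :
    ∑ i ∈ Finset.range (n + 1), ((n.choose i : ℕ) : ℝ) = 2 ^ n := by
  have h := Nat.sum_range_choose n
  exact_mod_cast h

/-- Leibniz bound for a pointwise composition of operator-valued maps on an open set: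
`‖Dⁿ(y ↦ P(y) ∘ Q(y))(x)‖ ≤ ∑ C(n,i) ‖Dⁱ P(x)‖ ‖Dⁿ⁻ⁱ Q(x)‖` (composition is bilinear of norm
`≤ 1`; Mathlib's `norm_iteratedFDerivWithin_le_of_bilinear_of_le_one` for `compL`). [folklore] -/
theorem norm_iteratedFDeriv_clm_comp_le {X G₁ G₂ G₃ : Type*} [NormedAddCommGroup X]
    [NormedSpace ℝ X] [NormedAddCommGroup G₁] [NormedSpace ℝ G₁] [NormedAddCommGroup G₂]
    [NormedSpace ℝ G₂] [NormedAddCommGroup G₃] [NormedSpace ℝ G₃]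
    {P : X → G₂ →L[ℝ] G₃} {Q : X → G₁ →L[ℝ] G₂} {s : Set X} (hs : IsOpen s) {k : ℕ}
    (hP : ContDiffOn ℝ k P s) (hQ : ContDiffOn ℝ k Q s) {x : X} (hx : x ∈ s) {n : ℕ}
    (hn : n ≤ k) :
    ‖iteratedFDeriv ℝ n (fun y ↦ (P y).comp (Q y)) x‖ ≤
      ∑ i ∈ Finset.range (n + 1),
        (n.choose i : ℝ) * ‖iteratedFDeriv ℝ i P x‖ * ‖iteratedFDeriv ℝ (n - i) Q x‖ := by
  have key := (ContinuousLinearMap.compL ℝ G₁ G₂ G₃).norm_iteratedFDerivWithin_le_of_bilinear_of_le_one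
    (f := P) (g := Q) hP hQ hs.uniqueDiffOn hx (n := n) (by exact_mod_cast hn)
    (ContinuousLinearMap.norm_compL_le _ _ _ _)
  have e : (fun y ↦ ContinuousLinearMap.compL ℝ G₁ G₂ G₃ (P y) (Q y)) =
      fun y ↦ (P y).comp (Q y) := rfl
  rw [e, iteratedFDerivWithin_of_isOpen n hs hx] at key
  refine key.trans (le_of_eq (Finset.sum_congr rfl fun i _ ↦ ?_))
  rw [iteratedFDerivWithin_of_isOpen i hs hx, iteratedFDerivWithin_of_isOpen (n - i) hs hx]

/-- **The linear `Cᵏ` estimate for the coordinate pullback.** Let `θ` be `C^{k+1}` on an open set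
`s`, `B` be `Cᵏ` on an open set `t ⊇ θ(s)`, `x ∈ s`, and suppose `‖Dⁱθ(x)‖ ≤ Θ` for `1 ≤ i ≤ k + 1`
(`Θ ≥ 1`) and `‖DʲB(θ x)‖ ≤ N` for `j ≤ k` (`N ≥ 0`). Then for every `m ≤ k`,
`‖Dᵐ(bilinPullback θ B)(x)‖ ≤ 4ᵏ · k! · Θ^{k+2} · N` — linear in the bound `N` on `B`, with a
constant depending only on `k` and the `C^{k+1}` size of `θ` at `x` (Leibniz rule for the two
bilinear pairings and Faà di Bruno for `B ∘ θ`). [folklore] -/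
theorem norm_iteratedFDeriv_bilinPullback_le {θ : E → F} {B : F → F →L[ℝ] F →L[ℝ] ℝ}
    {s : Set E} {t : Set F} (hs : IsOpen s) (ht : IsOpen t) {k : ℕ}
    (hθ : ContDiffOn ℝ (k + 1) θ s) (hB : ContDiffOn ℝ k B t) (hst : MapsTo θ s t)
    {x : E} (hx : x ∈ s) {Θ N : ℝ} (hΘ₁ : 1 ≤ Θ) (hN : 0 ≤ N)
    (hθb : ∀ i, 1 ≤ i → i ≤ k + 1 → ‖iteratedFDeriv ℝ i θ x‖ ≤ Θ)
    (hBb : ∀ j, j ≤ k → ‖iteratedFDeriv ℝ j B (θ x)‖ ≤ N) {m : ℕ} (hm : m ≤ k) :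
    ‖iteratedFDeriv ℝ m (bilinPullback θ B) x‖ ≤ 4 ^ k * k ! * Θ ^ (k + 2) * N := by
  -- the players
  set L : E → E →L[ℝ] F := fderiv ℝ θ with hLdef
  set Q : E → E →L[ℝ] F →L[ℝ] ℝ := fun y ↦ (B (θ y)).comp (L y) with hQdef
  set P : E → (F →L[ℝ] ℝ) →L[ℝ] E →L[ℝ] ℝ := fun y ↦ ContinuousLinearMap.precomp ℝ (L y)
    with hPdef
  have hΘ₀ : 0 ≤ Θ := zero_le_one.trans hΘ₁
  have hθk1 : ContDiffOn ℝ ((k : ℕ∞) + 1) θ s := hθ.of_le (by exact_mod_cast le_rfl)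
  have hθk : ContDiffOn ℝ k θ s := hθ.of_le (by exact_mod_cast Nat.le_succ k)
  have hL : ContDiffOn ℝ k L s := hθk1.fderiv_of_isOpen hs le_rfl
  have hBθ : ContDiffOn ℝ k (fun y ↦ B (θ y)) s := hB.comp hθk hst
  have hQ : ContDiffOn ℝ k Q s := hBθ.clm_comp hL
  have hPeq : P = (ContinuousLinearMap.compL ℝ E F ℝ).flip ∘ L := by
    funext y
    exact precomp_eq_flip_compL _
  have hP : ContDiffOn ℝ k P s := by
    rw [hPeq]
    exact (ContinuousLinearMap.contDiff _).comp_contDiffOn hL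
  -- (ii) derivatives of the Jacobian
  have hLb : ∀ j, j ≤ k → ‖iteratedFDeriv ℝ j L x‖ ≤ Θ := fun j hj ↦ by
    rw [hLdef, norm_iteratedFDeriv_fderiv_of_isOpen hs hx j]
    exact hθb (j + 1) (by omega) (by omega)
  -- (i) Faà di Bruno for `B ∘ θ`
  have hBθb : ∀ c, c ≤ k → ‖iteratedFDeriv ℝ c (fun y ↦ B (θ y)) x‖ ≤ k ! * N * Θ ^ k := by
    intro c hc
    refine (norm_iteratedFDeriv_comp_le_of_bounds hs ht hθk hB hst hx hΘ₁
      (fun i h1 hi ↦ hθb i h1 (by omega)) hBb hc).trans ?_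
    have h1 : (c ! : ℝ) ≤ k ! := by exact_mod_cast Nat.factorial_le hc
    have h2 : Θ ^ c ≤ Θ ^ k := pow_le_pow_right₀ hΘ₁ hc
    have h3 : (0 : ℝ) ≤ c ! := by positivity
    calc (c ! : ℝ) * N * Θ ^ c ≤ k ! * N * Θ ^ c := by gcongr
      _ ≤ k ! * N * Θ ^ k := by gcongr
  -- (iii) Leibniz for `Q y = (B (θ y)).comp (L y)`
  have hQb : ∀ b, b ≤ k → ‖iteratedFDeriv ℝ b Q x‖ ≤ 2 ^ k * k ! * Θ ^ (k + 1) * N := by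
    intro b hb
    refine (norm_iteratedFDeriv_clm_comp_le (P := fun y ↦ B (θ y)) (Q := L) hs hBθ hL hx
      hb).trans ?_
    have hterm : ∀ i ∈ Finset.range (b + 1),
        (b.choose i : ℝ) * ‖iteratedFDeriv ℝ i (fun y ↦ B (θ y)) x‖ *
          ‖iteratedFDeriv ℝ (b - i) L x‖ ≤
        (b.choose i : ℝ) * (k ! * N * Θ ^ k * Θ) := by
      intro i hi
      have hi' : i ≤ b := Nat.lt_succ_iff.mp (Finset.mem_range.mp hi)
      rw [mul_assoc]
      refine mul_le_mul_of_nonneg_left ?_ (by positivity)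
      exact mul_le_mul (hBθb i (hi'.trans hb)) (hLb (b - i) (by omega)) (norm_nonneg _)
        (by positivity)
    refine (Finset.sum_le_sum hterm).trans ?_
    rw [← Finset.sum_mul, sum_range_choose_real]
    have h2 : (2 : ℝ) ^ b ≤ 2 ^ k := pow_le_pow_right₀ (by norm_num) hb
    calc (2 : ℝ) ^ b * (k ! * N * Θ ^ k * Θ) = 2 ^ b * (k ! * Θ ^ (k + 1) * N) := by ring
      _ ≤ 2 ^ k * (k ! * Θ ^ (k + 1) * N) := by gcongr
      _ = 2 ^ k * k ! * Θ ^ (k + 1) * N := by ring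
  -- (iv) the outer factor `P = compL.flip ∘ L`
  have hPb : ∀ a, a ≤ k → ‖iteratedFDeriv ℝ a P x‖ ≤ Θ := by
    intro a ha
    rw [hPeq, ← iteratedFDerivWithin_of_isOpen a hs hx,
      ContinuousLinearMap.iteratedFDerivWithin_comp_left _ ((hL x hx).of_le le_rfl)
        hs.uniqueDiffOn hx (by exact_mod_cast ha)]
    refine (ContinuousLinearMap.norm_compContinuousMultilinearMap_le _ _).trans ?_
    have hA : ‖(ContinuousLinearMap.compL ℝ E F ℝ).flip‖ ≤ 1 := by
      rw [ContinuousLinearMap.opNorm_flip]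
      exact ContinuousLinearMap.norm_compL_le _ _ _ _
    rw [iteratedFDerivWithin_of_isOpen a hs hx]
    calc ‖(ContinuousLinearMap.compL ℝ E F ℝ).flip‖ * ‖iteratedFDeriv ℝ a L x‖
        ≤ 1 * Θ := mul_le_mul hA (hLb a ha) (norm_nonneg _) zero_le_one
      _ = Θ := one_mul Θ
  -- (v) Leibniz for `bilinPullback θ B y = (P y).comp (Q y)`
  have hfun : bilinPullback θ B = fun y ↦ (P y).comp (Q y) := rfl
  rw [hfun]
  refine (norm_iteratedFDeriv_clm_comp_le hs hP hQ hx hm).trans ?_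
  have hterm : ∀ i ∈ Finset.range (m + 1),
      (m.choose i : ℝ) * ‖iteratedFDeriv ℝ i P x‖ * ‖iteratedFDeriv ℝ (m - i) Q x‖ ≤
      (m.choose i : ℝ) * (Θ * (2 ^ k * k ! * Θ ^ (k + 1) * N)) := by
    intro i hi
    have hi' : i ≤ m := Nat.lt_succ_iff.mp (Finset.mem_range.mp hi)
    rw [mul_assoc]
    refine mul_le_mul_of_nonneg_left ?_ (by positivity)
    exact mul_le_mul (hPb i (hi'.trans hm)) (hQb (m - i) (by omega)) (norm_nonneg _) hΘ₀
  refine (Finset.sum_le_sum hterm).trans ?_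
  rw [← Finset.sum_mul, sum_range_choose_real]
  have h2 : (2 : ℝ) ^ m ≤ 2 ^ k := pow_le_pow_right₀ (by norm_num) hm
  have h4 : (4 : ℝ) ^ k = 2 ^ k * 2 ^ k := by
    rw [← mul_pow]; norm_num
  calc (2 : ℝ) ^ m * (Θ * (2 ^ k * k ! * Θ ^ (k + 1) * N))
      = 2 ^ m * (2 ^ k * k ! * Θ ^ (k + 2) * N) := by ring
    _ ≤ 2 ^ k * (2 ^ k * k ! * Θ ^ (k + 2) * N) := by gcongr
    _ = 4 ^ k * k ! * Θ ^ (k + 2) * N := by rw [h4]; ring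

/-! ### Continuity of the pullback for `Cᵏ_loc` convergence to zero -/

/-- A `C^{k+1}` map on an open set has all derivatives of orders `1 ≤ i ≤ k + 1` bounded by a
common constant `Θ ≥ 1` on any compact subset. [folklore] -/
theorem exists_bound_iteratedFDeriv_of_isCompact {θ : E → F} {s : Set E} (hs : IsOpen s)
    {k : ℕ} (hθ : ContDiffOn ℝ (k + 1) θ s) {K : Set E} (hK : IsCompact K) (hKs : K ⊆ s) :
    ∃ Θ : ℝ, 1 ≤ Θ ∧ ∀ i, 1 ≤ i → i ≤ k + 1 → ∀ x ∈ K, ‖iteratedFDeriv ℝ i θ x‖ ≤ Θ := by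
  have hcont : ∀ i, i ≤ k + 1 → ContinuousOn (iteratedFDeriv ℝ i θ) K := by
    intro i hi
    have h1 : ContinuousOn (iteratedFDerivWithin ℝ i θ s) s :=
      hθ.continuousOn_iteratedFDerivWithin (by exact_mod_cast hi) hs.uniqueDiffOn
    exact (h1.congr fun y hy ↦ (iteratedFDerivWithin_of_isOpen i hs hy).symm).mono hKs
  choose! C hC using fun i (hi : i ≤ k + 1) ↦ hK.exists_bound_of_continuousOn (hcont i hi)
  refine ⟨max 1 (∑ i ∈ Finset.range (k + 2), |C i|), le_max_left _ _, fun i h1 hi x hx ↦ ?_⟩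
  refine ((hC i hi x hx).trans (le_abs_self _)).trans ((Finset.single_le_sum
    (f := fun i ↦ |C i|) (fun j _ ↦ abs_nonneg (C j))
    (Finset.mem_range.mpr (by omega))).trans (le_max_right _ _))

/-- **Pulling back along a fixed smooth map is continuous for `Cᵏ_loc` convergence to zero.**
Let `θ` be `C^{k+1}` on an open set `s ⊇ K`, `K` compact, with `θ(K) ⊆ K'`; let `B i` be a family
of fields of bilinear forms, eventually `Cᵏ` on open neighbourhoods of `K'`, whose `Cᵏ` sup norms
on `K'` tend to `0`. Then the `Cᵏ` sup norms on `K` of the coordinate pullbacks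
`bilinPullback θ (B i)` tend to `0` (Petersen 2006, Ch. 10, §3.2: componentwise `Cᵏ` convergence
of tensors is independent of the charts used). [cite: Petersen2006, Ch. 10 §3.2] -/
theorem tendsto_supCkENorm_bilinPullback {ι : Type*} {l : Filter ι} {θ : E → F} {s : Set E}
    (hs : IsOpen s) {k : ℕ} (hθ : ContDiffOn ℝ (k + 1) θ s) {K : Set E} (hK : IsCompact K)
    (hKs : K ⊆ s) {K' : Set F} (hθK : MapsTo θ K K') {B : ι → F → F →L[ℝ] F →L[ℝ] ℝ}
    (hB : ∀ᶠ i in l, ∃ t : Set F, IsOpen t ∧ K' ⊆ t ∧ ContDiffOn ℝ k (B i) t)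
    (hlim : Tendsto (fun i ↦ supCkENorm K' k (B i)) l (𝓝 0)) :
    Tendsto (fun i ↦ supCkENorm K k (bilinPullback θ (B i))) l (𝓝 0) := by
  obtain ⟨Θ, hΘ₁, hΘ⟩ := exists_bound_iteratedFDeriv_of_isCompact hs hθ hK hKs
  set A : ℝ := 4 ^ k * k ! * Θ ^ (k + 2) with hA
  -- the real bounds `N i`
  have hfin : ∀ᶠ i in l, supCkENorm K' k (B i) < 1 := (tendsto_order.1 hlim).2 1 zero_lt_one
  have hN : Tendsto (fun i ↦ (supCkENorm K' k (B i)).toReal) l (𝓝 0) := by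
    have h := (ENNReal.tendsto_toReal ENNReal.zero_ne_top).comp hlim
    rw [ENNReal.toReal_zero] at h
    exact h
  have hupper : Tendsto (fun i ↦ ENNReal.ofReal (A * (supCkENorm K' k (B i)).toReal)) l (𝓝 0) := by
    have h := ENNReal.tendsto_ofReal (hN.const_mul A)
    simpa using h
  refine tendsto_of_tendsto_of_tendsto_of_le_of_le' tendsto_const_nhds hupper
    (Eventually.of_forall fun _ ↦ zero_le) ?_
  filter_upwards [hB, hfin] with i hBi hfi
  obtain ⟨t, ht, hK't, hBt⟩ := hBi
  -- work on the open set `s' = s ∩ θ⁻¹ t ⊇ K`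
  set s' : Set E := s ∩ θ ⁻¹' t with hs'
  have hs'o : IsOpen s' := hθ.continuousOn.isOpen_inter_preimage hs ht
  have hKs' : K ⊆ s' := fun x hx ↦ ⟨hKs hx, hK't (hθK hx)⟩
  have hθ' : ContDiffOn ℝ (k + 1) θ s' := hθ.mono inter_subset_left
  have hst : MapsTo θ s' t := fun x hx ↦ hx.2
  have hfin' : supCkENorm K' k (B i) ≠ ⊤ := (hfi.trans ENNReal.one_lt_top).ne
  refine supCkENorm_le_ofReal fun m hm x hx ↦ ?_
  exact norm_iteratedFDeriv_bilinPullback_le hs'o ht hθ' hBt hst (hKs' hx) hΘ₁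
    ENNReal.toReal_nonneg (fun j h1 hj ↦ hΘ j h1 hj x hx)
    (fun j hj ↦ norm_iteratedFDeriv_le_toReal_supCkENorm hj (hθK hx) _ hfin') hm

end BilinPullback

end Literature.Geometry.Lorentzian
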